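import Literature.NumberTheory.GaloisRepresentations.LocalCanonicalFundamentalClassTower
import HarnessLib

/-!
# The canonical fundamental class `u_{L/K}` of an ABSTRACT finite Galois extension `L/K` of a local field,
# `inv_{L/K}(u_{L/K}) = 1/[L:K]` (Serre, *Local Fields* XIII §4; Neukirch, *Bonn Lectures* II §5 (5.5)–(5.6))

Topic `NumberTheory/GaloisRepresentations` (local class field theory); namespace
`Literature.NumberTheory.GaloisRepresentations.UnitsLayer`.  Definitions with bodies and theorems; no
named fact, no instance, no notation.  Sequel to `LocalCanonicalFundamentalClass` /
`LocalCanonicalFundamentalClassTower` (door-c6 g10), which treat layers `L ⊆ K̄` given as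
`IntermediateField K (AlgebraicClosure K)`.  The Poitou–Tate / idèle-class consumers (door-c5's
completions `E_w / F_v`, door-c4's `galoisRep F E`) have their layers as TYPES `L` with `[Algebra K L]`;
this file packages the canonical class for them:

* §1 `unitsCohomologyIso e n : Hⁿ(Gal(E₁/K), E₁ˣ) ≅ Hⁿ(Gal(E₂/K), E₂ˣ)` for `e : E₁ ≃ₐ[K] E₂` (Mathlib
  `groupCohomology.mapIso`; door-c6 g9 proved `Nonempty`, here a definition).
* §2 for a char-0 non-archimedean local field `K : Type` and a finite Galois `L : Type` over `K`:
  **`layerInv K L : H²(Gal(L/K), Lˣ) →+ ℚ/ℤ`** := `inv_K ∘ unitsInfTwo ∘ (transport to the embedded copy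
  embeddedField K L ⊆ K̄)`; `layerInv_injective`, `finrank_nsmul_layerInv`, **`range_layerInv`**
  (`= (1/[L:K])ℤ/ℤ`), `existsUnique_layerInv_eq`.
* §3 **`fundamentalClass K L : H²(Gal(L/K), Lˣ)`** — THE class with `layerInv = 1/[L:K]`
  (`layerInv_fundamentalClass`, `eq_fundamentalClass_of_layerInv_eq`, `addOrderOf_fundamentalClass`,
  `exists_eq_zsmul_fundamentalClass`), the dictionary **`isClassModule_iff_isUnit_of_layerInv_eq`** and
  **`exists_isClassModule_H2π_eq_fundamentalClass`**: a 2-cocycle `φ` with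
  `IsClassModule (Rep.ofAlgebraAutOnUnits K L) φ` and `[φ] = fundamentalClass K L` — so every engine
  dot-lemma (`IsClassModule.tateIso`, `tateNakayamaIso`, `reciprocityAddEquiv`, `normResidueSymbol`) is
  available on the CANONICALLY normalised local class formation of an abstract layer.

Dependence on the embedding `L ↪ K̄` (`embeddingToAbs = IsAlgClosed.lift`): the invariant read through a
different `K`-embedding differs by an inner automorphism of `Gal(L/K)`, which acts trivially on `H²`; this
independence is NOT proved here (not needed by consumers, who use the one fixed embedding).
HONEST FRAMING: classical local class field theory; no case of BSD / Poitou–Tate is touched.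

## References
* J.-P. Serre, *Local Fields*, GTM 67 (1979), Ch. XIII §3 Prop. 6–7 and Cor., §4 (the class `u_{L/K}`);
  Ch. XI §1 (iv) (transport of structure). [SerreLocalFields1979]
* J. Neukirch, *Class Field Theory — The Bonn Lectures* (2013), Part II §5 Def. (5.5), Thm. (5.6).
  [Neukirch2013]
-/

noncomputable section

open CategoryTheory groupCohomology Field Function

namespace Literature.NumberTheory.GaloisRepresentations

namespace UnitsLayer

open Literature.Algebra.Homology
open Literature.AnabelianGeometry.AbsoluteAnabelian.Prop121vii

/-! ## §1. Transport of `Hⁿ(Gal(E/K), Eˣ)` along a `K`-isomorphism -/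

section Transport

variable {K E₁ E₂ : Type} [Field K] [Field E₁] [Field E₂] [Algebra K E₁] [Algebra K E₂]

/-- **`Hⁿ(Gal(E₁/K), E₁ˣ) ≅ Hⁿ(Gal(E₂/K), E₂ˣ)` along `e : E₁ ≃ₐ[K] E₂`** (`σ ↦ e σ e⁻¹` on the groups,
`Units.map e` on the units; Mathlib `groupCohomology.mapIso`).  Door-c6 g9's
`nonempty_groupCohomology_units_iso_of_algEquiv`, as a definition. [cite: SerreLocalFields1979, Ch. XI §1 (iv)] -/
def unitsCohomologyIso (e : E₁ ≃ₐ[K] E₂) (n : ℕ) :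
    groupCohomology (Rep.ofAlgebraAutOnUnits K E₁) n ≅ groupCohomology (Rep.ofAlgebraAutOnUnits K E₂) n :=
  groupCohomology.mapIso e.autCongr ((Units.mapEquiv (e : E₁ ≃* E₂)).toAdditive.toIntLinearEquiv)
    (fun g => by
      apply LinearMap.ext
      intro x
      refine Additive.toMul.injective (Units.ext ?_)
      change e ((g • (Additive.toMul x : E₁ˣ) : E₁ˣ) : E₁) =
        ((e.autCongr g • (Units.mapEquiv (e : E₁ ≃* E₂) (Additive.toMul x)) : E₂ˣ) : E₂)
      rw [AlgEquiv.smul_units_def, AlgEquiv.smul_units_def, Units.coe_map, Units.coe_map,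
        MonoidHom.coe_coe, MonoidHom.coe_coe, Units.coe_mapEquiv, AlgEquiv.autCongr_apply,
        AlgEquiv.trans_apply, AlgEquiv.trans_apply]
      exact congrArg (fun y => e (g y)) (e.symm_apply_apply (Additive.toMul x : E₁ˣ)).symm) n

/-- The transport is injective (it is an isomorphism). [cite: SerreLocalFields1979, Ch. XI §1 (iv)] -/
theorem unitsCohomologyIso_hom_injective (e : E₁ ≃ₐ[K] E₂) (n : ℕ) :
    Injective (unitsCohomologyIso e n).hom :=
  (unitsCohomologyIso e n).toLinearEquiv.injective

/-- The transport is surjective. [cite: SerreLocalFields1979, Ch. XI §1 (iv)] -/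
theorem unitsCohomologyIso_hom_surjective (e : E₁ ≃ₐ[K] E₂) (n : ℕ) :
    Surjective (unitsCohomologyIso e n).hom :=
  (unitsCohomologyIso e n).toLinearEquiv.surjective

end Transport

/-! ## §2. The invariant map of an abstract layer -/

section Abstract

variable (K : Type) [Field K] [ValuativeRel K] [TopologicalSpace K] [IsNonarchimedeanLocalField K]
  [CharZero K]
variable (L : Type) [Field L] [Algebra K L] [FiniteDimensional K L] [IsGalois K L]

/-- **THE invariant map `inv_{L/K} : H²(Gal(L/K), Lˣ) →+ ℚ/ℤ` of an abstract finite Galois extension `L/K`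
of a char-0 non-archimedean local field**: transport to the embedded copy `L₀ = embeddedField K L ⊆ K̄`
(`embeddedEquiv`), inflate into `Br(K) = H²(K, K̄ˣ)` (`unitsInfTwo`), take THE invariant
(`Prop121vii.brauerInvariantEquiv`). [cite: SerreLocalFields1979, Ch. XIII §3 (the map `inv_K`)]
[cite: Neukirch2013, Part II §5 Def. (5.5)] -/
def layerInv : groupCohomology (Rep.ofAlgebraAutOnUnits K L) 2 →+ AddCircle (1 : ℚ) :=
  (brauerInvariantEquiv K).toAddMonoidHom.comp ((unitsInfTwo K (embeddedField K L)).comp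
    (unitsCohomologyIso (embeddedEquiv K L) 2).hom.hom.toAddMonoidHom)

/-- Unfolding `layerInv`. [cite: SerreLocalFields1979, Ch. XIII §3] -/
theorem layerInv_apply (x : groupCohomology (Rep.ofAlgebraAutOnUnits K L) 2) :
    layerInv K L x = brauerInvariantEquiv K (unitsInfTwo K (embeddedField K L)
      ((unitsCohomologyIso (embeddedEquiv K L) 2).hom x)) := rfl

/-- **`inv_{L/K}` is injective.** [cite: SerreLocalFields1979, Ch. XIII §3 Prop. 6] -/
theorem layerInv_injective : Injective (layerInv K L) :=
  (brauerInvariantEquiv_unitsInfTwo_injective K (embeddedField K L)).comp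
    (unitsCohomologyIso_hom_injective (embeddedEquiv K L) 2)

/-- `[L:K] · inv_{L/K}(x) = 0` (`H²(Gal(L/K), Lˣ)` has order `[L:K]`). [cite: SerreLocalFields1979, Ch. XIII §3 Prop. 6] -/
theorem finrank_nsmul_layerInv (x : groupCohomology (Rep.ofAlgebraAutOnUnits K L) 2) :
    Module.finrank K L • layerInv K L x = 0 := by
  have h := addOrderOf_dvd_natCard x
  rw [natCard_H2_units_eq_finrank_of_isGalois K L] at h
  rw [← map_nsmul, addOrderOf_dvd_iff_nsmul_eq_zero.1 h, map_zero]

variable {n : ℕ} [NeZero n]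

/-- **`inv_{L/K}(H²(Gal(L/K), Lˣ)) = (1/[L:K])ℤ/ℤ`** for an abstract layer (transport of
`range_brauerInvariantEquiv_unitsInfTwo` at the embedded copy, `[L₀:K] = [L:K]`).
[cite: SerreLocalFields1979, Ch. XIII §3 Prop. 6 and Cor. 2 to Prop. 7] -/
theorem range_layerInv (hn : Module.finrank K L = n) :
    Set.range (layerInv K L) = Set.range (zmodToQmodZ n) := by
  have hn₀ : Module.finrank K (embeddedField K L) = n := by rw [finrank_embeddedField, hn]
  rw [← range_brauerInvariantEquiv_unitsInfTwo K (embeddedField K L) hn₀]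
  ext t
  constructor
  · rintro ⟨x, rfl⟩
    exact ⟨(unitsCohomologyIso (embeddedEquiv K L) 2).hom x, rfl⟩
  · rintro ⟨y, rfl⟩
    obtain ⟨x, rfl⟩ := unitsCohomologyIso_hom_surjective (embeddedEquiv K L) 2 y
    exact ⟨x, rfl⟩

/-- Every `a/[L:K]` is `inv_{L/K}` of exactly one class. [cite: SerreLocalFields1979, Ch. XIII §3 Prop. 6] -/
theorem existsUnique_layerInv_eq (hn : Module.finrank K L = n) (a : ZMod n) :
    ∃! x : groupCohomology (Rep.ofAlgebraAutOnUnits K L) 2, layerInv K L x = zmodToQmodZ n a := by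
  have hmem : zmodToQmodZ n a ∈ Set.range (layerInv K L) := by
    rw [range_layerInv K L hn]
    exact ⟨a, rfl⟩
  obtain ⟨x, hx⟩ := hmem
  exact ⟨x, hx, fun y hy => layerInv_injective K L (hy.trans hx.symm)⟩

/-- Every invariant is some `a/[L:K]`. [cite: SerreLocalFields1979, Ch. XIII §3 Cor. 2 to Prop. 7] -/
theorem exists_layerInv_eq_zmodToQmodZ (hn : Module.finrank K L = n)
    (x : groupCohomology (Rep.ofAlgebraAutOnUnits K L) 2) : ∃ a : ZMod n, layerInv K L x = zmodToQmodZ n a := by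
  have h : layerInv K L x ∈ Set.range (zmodToQmodZ n) := by
    rw [← range_layerInv K L hn]
    exact ⟨x, rfl⟩
  obtain ⟨a, ha⟩ := h
  exact ⟨a, ha.symm⟩

/-- `ord(x) = ord(a)` when `inv_{L/K}(x) = a/[L:K]`. [cite: SerreLocalFields1979, Ch. XIII §3 Prop. 6] -/
theorem addOrderOf_eq_of_layerInv_eq {x : groupCohomology (Rep.ofAlgebraAutOnUnits K L) 2} {a : ZMod n}
    (hx : layerInv K L x = zmodToQmodZ n a) : addOrderOf x = addOrderOf a := by
  rw [← addOrderOf_zmodToQmodZ n a, ← hx]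
  exact (addOrderOf_injective (layerInv K L) (layerInv_injective K L) x).symm

/-! ## §3. The canonical fundamental class of an abstract layer and the engine's class modules -/

/-- **Dictionary engine ↔ tree for an abstract layer**: a 2-cocycle `φ` of `Lˣ` with `inv_{L/K}[φ] = a/[L:K]`
is a fundamental class of the class module `(Gal(L/K), Lˣ)` in the engine's sense (`IsClassModule`) iff `a`
is a unit of `ℤ/[L:K]`. [cite: SerreLocalFields1979, Ch. XIII §4 Thm. 1][cite: Neukirch2013, Part I §7 Thm. (7.3) Addendum] -/
theorem isClassModule_iff_isUnit_of_layerInv_eq (hn : Module.finrank K L = n)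
    (φ : cocycles₂ (Rep.ofAlgebraAutOnUnits K L)) {a : ZMod n}
    (hφ : layerInv K L (H2π (Rep.ofAlgebraAutOnUnits K L) φ) = zmodToQmodZ n a) :
    IsClassModule (Rep.ofAlgebraAutOnUnits K L) φ ↔ IsUnit a := by
  rw [isClassModule_iff_card, ← ZMod.addOrderOf_eq_iff_isUnit, ← addOrderOf_eq_of_layerInv_eq K L hφ,
    IsGalois.card_aut_eq_finrank, hn]
  exact ⟨fun h => h.2.2, fun h => ⟨isZero_H1_res_units K L, natCard_H2_res_units_of_isGalois K L, h⟩⟩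

/-- **THE CANONICAL FUNDAMENTAL CLASS `u_{L/K} ∈ H²(Gal(L/K), Lˣ)`** of an abstract finite Galois extension
of a char-0 non-archimedean local field: the unique class with `inv_{L/K}(u_{L/K}) = 1/[L:K]`
(Serre XIII §4; Neukirch II (5.5)). [cite: SerreLocalFields1979, Ch. XIII §4 (definition of `u_{L/K}`)]
[cite: Neukirch2013, Part II §5 Def. (5.5)] -/
def fundamentalClass : groupCohomology (Rep.ofAlgebraAutOnUnits K L) 2 :=
  haveI : NeZero (Module.finrank K L) := ⟨Module.finrank_pos.ne'⟩
  (existsUnique_layerInv_eq K L (n := Module.finrank K L) rfl 1).exists.choose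

/-- **`inv_{L/K}(u_{L/K}) = 1/[L:K]`** (as `zmodToQmodZ [L:K] 1`). [cite: SerreLocalFields1979, Ch. XIII §4] -/
theorem layerInv_fundamentalClass_eq_zmodToQmodZ :
    haveI : NeZero (Module.finrank K L) := ⟨Module.finrank_pos.ne'⟩
    layerInv K L (fundamentalClass K L) = zmodToQmodZ (Module.finrank K L) 1 :=
  haveI : NeZero (Module.finrank K L) := ⟨Module.finrank_pos.ne'⟩
  (existsUnique_layerInv_eq K L (n := Module.finrank K L) rfl 1).exists.choose_spec

/-- **`inv_{L/K}(u_{L/K}) = 1/[L:K] ∈ ℚ/ℤ`.** [cite: SerreLocalFields1979, Ch. XIII §4][cite: Neukirch2013, Part II §5 Def. (5.5)] -/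
theorem layerInv_fundamentalClass :
    layerInv K L (fundamentalClass K L) = (((1 : ℚ) / Module.finrank K L : ℚ) : AddCircle (1 : ℚ)) := by
  haveI : NeZero (Module.finrank K L) := ⟨Module.finrank_pos.ne'⟩
  rw [layerInv_fundamentalClass_eq_zmodToQmodZ, zmodToQmodZ_one_eq]

/-- With `[L:K] = n`: `inv_{L/K}(u_{L/K}) = zmodToQmodZ n 1`. [cite: SerreLocalFields1979, Ch. XIII §4] -/
theorem layerInv_fundamentalClass_of_finrank_eq (hn : Module.finrank K L = n) :
    layerInv K L (fundamentalClass K L) = zmodToQmodZ n 1 := by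
  rw [layerInv_fundamentalClass, zmodToQmodZ_one_eq, hn]

/-- **Uniqueness**: a class with invariant `1/[L:K]` IS `u_{L/K}`. [cite: SerreLocalFields1979, Ch. XIII §4] -/
theorem eq_fundamentalClass_of_layerInv_eq {x : groupCohomology (Rep.ofAlgebraAutOnUnits K L) 2}
    (hx : layerInv K L x = (((1 : ℚ) / Module.finrank K L : ℚ) : AddCircle (1 : ℚ))) : x = fundamentalClass K L :=
  layerInv_injective K L (hx.trans (layerInv_fundamentalClass K L).symm)

/-- **`u_{L/K}` has order `[L:K]`** (it generates the cyclic group `H²(Gal(L/K), Lˣ)`).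
[cite: SerreLocalFields1979, Ch. XIII §3 Prop. 6, §4] -/
theorem addOrderOf_fundamentalClass : addOrderOf (fundamentalClass K L) = Module.finrank K L := by
  haveI : NeZero (Module.finrank K L) := ⟨Module.finrank_pos.ne'⟩
  rw [addOrderOf_eq_of_layerInv_eq K L (layerInv_fundamentalClass_eq_zmodToQmodZ K L), ZMod.addOrderOf_eq_iff_isUnit]
  exact isUnit_one

/-- **Every class is an integer multiple of `u_{L/K}`**, the multiplier read off the invariant:
`inv_{L/K}(x) = k/[L:K] ⟹ x = k · u_{L/K}`. [cite: SerreLocalFields1979, Ch. XIII §3 Prop. 6, §4] -/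
theorem eq_zsmul_fundamentalClass_of_layerInv_eq (hn : Module.finrank K L = n)
    {x : groupCohomology (Rep.ofAlgebraAutOnUnits K L) 2} (k : ℤ) (hx : layerInv K L x = zmodToQmodZ n (k : ZMod n)) :
    x = k • fundamentalClass K L := by
  apply layerInv_injective K L
  rw [map_zsmul, layerInv_fundamentalClass_of_finrank_eq K L hn, hx, ← map_zsmul, zsmul_eq_mul, mul_one]

/-- **`H²(Gal(L/K), Lˣ) = ℤ · u_{L/K}`**: every class is `k · u_{L/K}` for some integer `k`.
[cite: SerreLocalFields1979, Ch. XIII §3 Prop. 6, §4] -/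
theorem exists_eq_zsmul_fundamentalClass (x : groupCohomology (Rep.ofAlgebraAutOnUnits K L) 2) :
    ∃ k : ℤ, x = k • fundamentalClass K L := by
  haveI : NeZero (Module.finrank K L) := ⟨Module.finrank_pos.ne'⟩
  obtain ⟨a, ha⟩ := exists_layerInv_eq_zmodToQmodZ K L (n := Module.finrank K L) rfl x
  refine ⟨(a.val : ℤ), eq_zsmul_fundamentalClass_of_layerInv_eq K L rfl _ ?_⟩
  rw [ha, Int.cast_natCast, ZMod.natCast_zmod_val]

/-- **The canonical class generates the engine's class module**: there is a 2-cocycle `φ` of `Lˣ` with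
`IsClassModule (Rep.ofAlgebraAutOnUnits K L) φ` and `[φ] = u_{L/K}` — every engine dot-lemma
(Tate's theorem, Tate–Nakayama, the norm residue isomorphism) on the CANONICALLY normalised local layer.
[cite: SerreLocalFields1979, Ch. XIII §4 Thm. 1][cite: Neukirch2013, Part II §5 Thm. (5.6)] -/
theorem exists_isClassModule_H2π_eq_fundamentalClass :
    ∃ φ : cocycles₂ (Rep.ofAlgebraAutOnUnits K L), IsClassModule (Rep.ofAlgebraAutOnUnits K L) φ ∧
      H2π (Rep.ofAlgebraAutOnUnits K L) φ = fundamentalClass K L := by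
  haveI : NeZero (Module.finrank K L) := ⟨Module.finrank_pos.ne'⟩
  obtain ⟨φ, hφ⟩ : ∃ φ : cocycles₂ (Rep.ofAlgebraAutOnUnits K L),
      H2π (Rep.ofAlgebraAutOnUnits K L) φ = fundamentalClass K L := by
    induction fundamentalClass K L using H2_induction_on with
    | h φ => exact ⟨φ, rfl⟩
  refine ⟨φ, (isClassModule_iff_isUnit_of_layerInv_eq K L (n := Module.finrank K L) rfl φ
    (a := 1) ?_).2 isUnit_one, hφ⟩
  rw [hφ, layerInv_fundamentalClass_eq_zmodToQmodZ]

/-- **Every engine fundamental class is a UNIT multiple of `u_{L/K}`**: `IsClassModule φ ⟹ [φ] = a·u_{L/K}`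
with `a` a unit of `ℤ/[L:K]`. [cite: SerreLocalFields1979, Ch. XIII §4 Thm. 1][cite: Lang1996, Ch. III §3] -/
theorem IsClassModule.exists_isUnit_H2π_eq_zsmul_fundamentalClass (hn : Module.finrank K L = n)
    {φ : cocycles₂ (Rep.ofAlgebraAutOnUnits K L)} (hA : IsClassModule (Rep.ofAlgebraAutOnUnits K L) φ) :
    ∃ a : ZMod n, IsUnit a ∧ H2π (Rep.ofAlgebraAutOnUnits K L) φ = (a.val : ℤ) • fundamentalClass K L := by
  obtain ⟨a, ha⟩ := exists_layerInv_eq_zmodToQmodZ K L hn (H2π (Rep.ofAlgebraAutOnUnits K L) φ)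
  refine ⟨a, (isClassModule_iff_isUnit_of_layerInv_eq K L hn φ ha).1 hA,
    eq_zsmul_fundamentalClass_of_layerInv_eq K L hn _ ?_⟩
  rw [ha, Int.cast_natCast, ZMod.natCast_zmod_val]

end Abstract

end UnitsLayer

end Literature.NumberTheory.GaloisRepresentations

end
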